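import Summits.CriticalPhenomena.CardyFormulaZ2.Theorems.CardyBoundaryCoulombGasHalfPlaneMarkDensityLawJointLimitC1

/-!
# `HalfPlaneMarkDensityLaw` (crux stmt-CriticalPhenomena-5661), line `Sketch`:
# every joint limit is the INTEGRAL of its density; the TRANSLATION IDENTITY of the four densities
# (lead c4-0)

`G` a joint subsequential limit of `P_n(a,b,c,y) = P_{1/2}[[⌊an⌋,⌊bn⌋]×{0} ↔ [⌊cn⌋,⌊yn⌋]×{0} in ℤ×ℕ]`
along a strictly increasing `θ`; `∂₄G(a,b,c,·)` = the limit along `θ` of the crux's sequence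
(`hasDerivAt_jointLimit`), continuous (`continuousOn_deriv_jointLimit`).

* `integral_deriv₄_eq_sub` — fundamental theorem of calculus on `[x₀,x₁] ⊂ (c,∞)`:
  `∫_{x₀}^{x₁} ∂₄G(a,b,c,x) dx = G(a,b,c,x₁) − G(a,b,c,x₀)`;
* `tendsto_jointLimit_nhdsGT` — `G(a,b,c,y) → 0` as `y ↓ c` (c2-0's uniform target decay);
* `tendsto_integral_deriv₄` — hence **`G(a,b,c,x₁) = lim_{x₀ ↓ c} ∫_{x₀}^{x₁} ∂₄G`**: every joint
  subsequential scaling limit of the half-plane crossing probability is the (improper) integral of the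
  subsequential scaling limit of the crux's mark density — the unconditional, subsequential form of the
  route's "differentiate-to-neutrality, then integrate" (`DensityIntegration` / `PureProductIntegrates`):
  under the crux the integrand is `F′(η)∂ₓη` and the integral is `F∘η`;
* `sum_partials_eq_zero` (registered extra stub `stub_translationIdentity`) — **the translation identity**
  `∂₁G + ∂₂G + ∂₃G + ∂₄G = 0` on the chamber: the four boundary two-arm densities of any subsequential
  scaling limit (far-end density = the crux's, near-end density of `…NearEndRegularity`, and their
  reflections) satisfy one exact linear relation (translation invariance of the limit, c2-0's
  `translate_of_jointLimit`, one-variable mean value theorem in each mark, joint continuity of the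
  partials, `jointLimit_C1`).
-/

noncomputable section

namespace Summit.CriticalPhenomena.CardyFormulaZ2.Cruxes.HalfPlaneMarkDensityLaw.SketchLine

open Literature.Probability.Percolation Literature.Probability.LatticeModels
open MeasureTheory Filter Set
open scoped Topology
open Summit.CriticalPhenomena.CardyFormulaZ2.Theorems.HalfPlaneMarkDensityLaw.Negative

namespace Density

/-- The chamber `{a < b < c < y}` is open in `ℝ × ℝ × ℝ × ℝ`. [folklore] -/
theorem isOpen_chamber :
    IsOpen {p : ℝ × ℝ × ℝ × ℝ | p.1 < p.2.1 ∧ p.2.1 < p.2.2.1 ∧ p.2.2.1 < p.2.2.2} := by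
  have h1 : Continuous fun p : ℝ × ℝ × ℝ × ℝ ↦ p.1 := by fun_prop
  have h2 : Continuous fun p : ℝ × ℝ × ℝ × ℝ ↦ p.2.1 := by fun_prop
  have h3 : Continuous fun p : ℝ × ℝ × ℝ × ℝ ↦ p.2.2.1 := by fun_prop
  have h4 : Continuous fun p : ℝ × ℝ × ℝ × ℝ ↦ p.2.2.2 := by fun_prop
  exact (isOpen_lt h1 h2).inter ((isOpen_lt h2 h3).inter (isOpen_lt h3 h4))

section JointLimit

variable {θ : ℕ → ℕ} {G : ℝ → ℝ → ℝ → ℝ → ℝ}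
  (hG : ∀ a b c y : ℝ, a < b → b < c → c < y →
    Tendsto (fun n ↦ μ.real (openCrossing halfPlane (arcA a b (θ n))
      (rowIcc ⌊c * (θ n : ℕ)⌋ ⌊y * (θ n : ℕ)⌋))) atTop (𝓝 (G a b c y)))
include hG

/-! ### Every joint limit is the integral of its density -/

/-- **FTC for joint limits**: `∫_{x₀}^{x₁} ∂₄G(a,b,c,x) dx = G(a,b,c,x₁) − G(a,b,c,x₀)` for
`x₀, x₁ > c`. [folklore] -/
theorem integral_deriv₄_eq_sub (hθ : Tendsto θ atTop atTop) {a b c x₀ x₁ : ℝ} (hab : a < b)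
    (hbc : b < c) (hcx₀ : c < x₀) (hcx₁ : c < x₁) :
    ∫ x in x₀..x₁, deriv (G a b c) x = G a b c x₁ - G a b c x₀ := by
  have hmem : ∀ x ∈ uIcc x₀ x₁, c < x := by
    intro x hx
    rcases le_total x₀ x₁ with h | h
    · rw [uIcc_of_le h] at hx; linarith [hx.1]
    · rw [uIcc_of_ge h] at hx; linarith [hx.1]
  refine intervalIntegral.integral_eq_sub_of_hasDerivAt
    (fun x hx ↦ (hasDerivAt_jointLimit hG hθ hab hbc (hmem x hx)).1) ?_
  exact ((continuousOn_deriv_jointLimit hG hθ hab hbc).mono fun x hx ↦ hmem x hx).intervalIntegrable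

/-- **Joint limits vanish at the third mark**: `G(a,b,c,y) → 0` as `y ↓ c` (uniform target decay of
c2-0, `exists_jointLimit_target_decay`). [folklore] -/
theorem tendsto_jointLimit_nhdsGT (hθ : StrictMono θ) {a b c : ℝ} (hab : a < b) (hbc : b < c) :
    Tendsto (G a b c) (𝓝[>] c) (𝓝 0) := by
  obtain ⟨α, hα, hdec⟩ := Subseq.exists_jointLimit_target_decay
  have hup : Tendsto (fun y : ℝ ↦ (4 * (y - c) / (c - b)) ^ α) (𝓝[>] c) (𝓝 0) := by
    have hcont : ContinuousAt (fun y : ℝ ↦ (4 * (y - c) / (c - b)) ^ α) c := by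
      refine ContinuousAt.rpow_const (by fun_prop) (Or.inr hα.le)
    have h0 : (4 * (c - c) / (c - b)) ^ α = 0 := by
      rw [sub_self, mul_zero, zero_div, Real.zero_rpow hα.ne']
    have := hcont.tendsto
    rw [h0] at this
    exact this.mono_left nhdsWithin_le_nhds
  have hIoc : Ioc c (c + (c - b) / 8) ∈ 𝓝[>] c := Ioc_mem_nhdsGT (by linarith)
  refine tendsto_of_tendsto_of_tendsto_of_le_of_le' tendsto_const_nhds hup ?_ ?_
  · filter_upwards [self_mem_nhdsWithin] with y hy
    exact (Subseq.jointLimit_mem_Icc hG hab hbc hy).1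
  · filter_upwards [hIoc] with y hy
    exact hdec θ hθ G hG a b c y hab hbc hy.1 (by linarith [hy.2])

/-- **Every joint limit is the improper integral of its density**:
`∫_{x₀}^{x₁} ∂₄G(a,b,c,x) dx → G(a,b,c,x₁)` as `x₀ ↓ c`. [folklore] -/
theorem tendsto_integral_deriv₄ (hθ : StrictMono θ) {a b c x₁ : ℝ} (hab : a < b) (hbc : b < c)
    (hcx₁ : c < x₁) :
    Tendsto (fun x₀ ↦ ∫ x in x₀..x₁, deriv (G a b c) x) (𝓝[>] c) (𝓝 (G a b c x₁)) := by
  have h1 : (fun x₀ ↦ G a b c x₁ - G a b c x₀) =ᶠ[𝓝[>] c]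
      fun x₀ ↦ ∫ x in x₀..x₁, deriv (G a b c) x := by
    filter_upwards [self_mem_nhdsWithin] with x₀ hx₀
    exact (integral_deriv₄_eq_sub hG hθ.tendsto_atTop hab hbc hx₀ hcx₁).symm
  have h2 : Tendsto (fun x₀ ↦ G a b c x₁ - G a b c x₀) (𝓝[>] c) (𝓝 (G a b c x₁ - 0)) :=
    tendsto_const_nhds.sub (tendsto_jointLimit_nhdsGT hG hθ hab hbc)
  rw [sub_zero] at h2
  exact h2.congr' h1

/-- The integrals of the density over `[x₀, x₁] ⊂ (c,∞)` are bounded by `1`. [folklore] -/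
theorem integral_deriv₄_le_one (hθ : Tendsto θ atTop atTop) {a b c x₀ x₁ : ℝ} (hab : a < b)
    (hbc : b < c) (hcx₀ : c < x₀) (hx : x₀ ≤ x₁) :
    ∫ x in x₀..x₁, deriv (G a b c) x ≤ 1 := by
  rw [integral_deriv₄_eq_sub hG hθ hab hbc hcx₀ (by linarith)]
  have h1 := Subseq.jointLimit_mem_Icc hG hab hbc (show c < x₁ by linarith)
  have h0 := Subseq.jointLimit_mem_Icc hG hab hbc hcx₀
  linarith [h1.2, h0.1]

/-! ### The translation identity `∂₁G + ∂₂G + ∂₃G + ∂₄G = 0` -/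

/-- **The translation identity.** For a joint limit along a strictly increasing `θ` and every chamber
point: `∂₁G(a,b,c,y) + ∂₂G(a,b,c,y) + ∂₃G(a,b,c,y) + ∂₄G(a,b,c,y) = 0`. [folklore] -/
theorem sum_partials_eq_zero (hθ : StrictMono θ) {a b c y : ℝ} (hab : a < b) (hbc : b < c)
    (hcy : c < y) :
    deriv (fun s ↦ G s b c y) a + deriv (fun s ↦ G a s c y) b + deriv (fun s ↦ G a b s y) c +
      deriv (fun s ↦ G a b c s) y = 0 := by
  obtain ⟨hdiff, hc₁, hc₂, hc₃, hc₄⟩ := NearEnd.jointLimit_C1 hG hθ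
  -- the four partials as functions on `ℝ⁴`, continuous at the point
  set D₁ : ℝ × ℝ × ℝ × ℝ → ℝ := fun p ↦ deriv (fun s ↦ G s p.2.1 p.2.2.1 p.2.2.2) p.1 with hD₁
  set D₂ : ℝ × ℝ × ℝ × ℝ → ℝ := fun p ↦ deriv (fun s ↦ G p.1 s p.2.2.1 p.2.2.2) p.2.1 with hD₂
  set D₃ : ℝ × ℝ × ℝ × ℝ → ℝ := fun p ↦ deriv (fun s ↦ G p.1 p.2.1 s p.2.2.2) p.2.2.1 with hD₃
  set D₄ : ℝ × ℝ × ℝ × ℝ → ℝ := fun p ↦ deriv (fun s ↦ G p.1 p.2.1 p.2.2.1 s) p.2.2.2 with hD₄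
  have hp : ((a, b, c, y) : ℝ × ℝ × ℝ × ℝ) ∈
      {p : ℝ × ℝ × ℝ × ℝ | p.1 < p.2.1 ∧ p.2.1 < p.2.2.1 ∧ p.2.2.1 < p.2.2.2} := ⟨hab, hbc, hcy⟩
  have hnhds := isOpen_chamber.mem_nhds hp
  have hA₁ : ContinuousAt D₁ (a, b, c, y) := hc₁.continuousAt hnhds
  have hA₂ : ContinuousAt D₂ (a, b, c, y) := hc₂.continuousAt hnhds
  have hA₃ : ContinuousAt D₃ (a, b, c, y) := hc₃.continuousAt hnhds
  have hA₄ : ContinuousAt D₄ (a, b, c, y) := hc₄.continuousAt hnhds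
  -- it suffices to show `|Σ| ≤ ε` for every `ε > 0`
  set S : ℝ := deriv (fun s ↦ G s b c y) a + deriv (fun s ↦ G a s c y) b +
    deriv (fun s ↦ G a b s y) c + deriv (fun s ↦ G a b c s) y with hS
  suffices h : ∀ ε : ℝ, 0 < ε → |S| ≤ ε by
    by_contra hne
    have hpos : 0 < |S| := abs_pos.2 hne
    have := h (|S| / 2) (by positivity)
    linarith
  intro ε hε
  -- uniform closeness of the partials near the point
  have hnear : ∀ {D : ℝ × ℝ × ℝ × ℝ → ℝ}, ContinuousAt D (a, b, c, y) →
      ∃ δ : ℝ, 0 < δ ∧ ∀ q : ℝ × ℝ × ℝ × ℝ, dist q (a, b, c, y) < δ → |D q - D (a, b, c, y)| < ε / 4 := by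
    intro D hD
    have := Metric.continuousAt_iff.1 hD (ε / 4) (by positivity)
    obtain ⟨δ, hδ, h⟩ := this
    exact ⟨δ, hδ, fun q hq ↦ by simpa only [Real.dist_eq] using h hq⟩
  obtain ⟨δ₁, hδ₁, hn₁⟩ := hnear hA₁
  obtain ⟨δ₂, hδ₂, hn₂⟩ := hnear hA₂
  obtain ⟨δ₃, hδ₃, hn₃⟩ := hnear hA₃
  obtain ⟨δ₄, hδ₄, hn₄⟩ := hnear hA₄
  -- the translation step `s`
  obtain ⟨s, hs, hs₁, hs₂, hs₃, hs₄⟩ : ∃ s : ℝ, 0 < s ∧ s < δ₁ ∧ s < δ₂ ∧ s < δ₃ ∧ s < δ₄ := by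
    set m : ℝ := min (min δ₁ δ₂) (min δ₃ δ₄) with hm_def
    have hm0 : 0 < m := by rw [hm_def]; positivity
    have hm1 : m ≤ δ₁ := (min_le_left _ _).trans (min_le_left _ _)
    have hm2 : m ≤ δ₂ := (min_le_left _ _).trans (min_le_right _ _)
    have hm3 : m ≤ δ₃ := (min_le_right _ _).trans (min_le_left _ _)
    have hm4 : m ≤ δ₄ := (min_le_right _ _).trans (min_le_right _ _)
    exact ⟨m / 2, by positivity, by linarith, by linarith, by linarith, by linarith⟩
  have hss : |s| ≤ s := (abs_of_pos hs).le
  have h00 : ∀ u : ℝ, |u - u| ≤ s := fun u ↦ by rw [sub_self, abs_zero]; exact hs.le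
  have hus : ∀ u : ℝ, |u + s - u| ≤ s := fun u ↦ by rw [add_sub_cancel_left]; exact hss
  -- translation invariance: the total increment vanishes
  have htr : G (a + s) (b + s) (c + s) (y + s) = G a b c y :=
    Subseq.translate_of_jointLimit hG hθ hab hbc hcy s
  -- mean value theorem in each mark
  -- (1) first mark, on `[a, a+s]` at marks `(b+s, c+s, y+s)`
  obtain ⟨ξ₁, hξ₁, hmvt₁⟩ : ∃ ξ ∈ Ioo a (a + s), deriv (fun u ↦ G u (b + s) (c + s) (y + s)) ξ =
      (G (a + s) (b + s) (c + s) (y + s) - G a (b + s) (c + s) (y + s)) / (a + s - a) := by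
    have hd : ∀ u ∈ Icc a (a + s), HasDerivAt (fun u ↦ G u (b + s) (c + s) (y + s))
        (deriv (fun u ↦ G u (b + s) (c + s) (y + s)) u) u := fun u hu ↦
      (hdiff u (b + s) (c + s) (y + s) (by linarith [hu.2]) (by linarith) (by linarith)).1.hasDerivAt
    exact exists_hasDerivAt_eq_slope _ _ (by linarith) (HasDerivAt.continuousOn fun u hu ↦ hd u hu)
      fun u hu ↦ hd u (Ioo_subset_Icc_self hu)
  -- (2) second mark, on `[b, b+s]` at marks `(a, ·, c+s, y+s)`
  obtain ⟨ξ₂, hξ₂, hmvt₂⟩ : ∃ ξ ∈ Ioo b (b + s), deriv (fun u ↦ G a u (c + s) (y + s)) ξ =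
      (G a (b + s) (c + s) (y + s) - G a b (c + s) (y + s)) / (b + s - b) := by
    have hd : ∀ u ∈ Icc b (b + s), HasDerivAt (fun u ↦ G a u (c + s) (y + s))
        (deriv (fun u ↦ G a u (c + s) (y + s)) u) u := fun u hu ↦
      (hdiff a u (c + s) (y + s) (by linarith [hu.1]) (by linarith [hu.2]) (by linarith)).2.1.hasDerivAt
    exact exists_hasDerivAt_eq_slope _ _ (by linarith) (HasDerivAt.continuousOn fun u hu ↦ hd u hu)
      fun u hu ↦ hd u (Ioo_subset_Icc_self hu)
  -- (3) third mark, on `[c, c+s]` at marks `(a, b, ·, y+s)`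
  obtain ⟨ξ₃, hξ₃, hmvt₃⟩ : ∃ ξ ∈ Ioo c (c + s), deriv (fun u ↦ G a b u (y + s)) ξ =
      (G a b (c + s) (y + s) - G a b c (y + s)) / (c + s - c) := by
    have hd : ∀ u ∈ Icc c (c + s), HasDerivAt (fun u ↦ G a b u (y + s))
        (deriv (fun u ↦ G a b u (y + s)) u) u := fun u hu ↦
      (hdiff a b u (y + s) hab (by linarith [hu.1]) (by linarith [hu.2])).2.2.1.hasDerivAt
    exact exists_hasDerivAt_eq_slope _ _ (by linarith) (HasDerivAt.continuousOn fun u hu ↦ hd u hu)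
      fun u hu ↦ hd u (Ioo_subset_Icc_self hu)
  -- (4) fourth mark, on `[y, y+s]` at marks `(a, b, c, ·)`
  obtain ⟨ξ₄, hξ₄, hmvt₄⟩ : ∃ ξ ∈ Ioo y (y + s), deriv (fun u ↦ G a b c u) ξ =
      (G a b c (y + s) - G a b c y) / (y + s - y) := by
    have hd : ∀ u ∈ Icc y (y + s), HasDerivAt (fun u ↦ G a b c u)
        (deriv (fun u ↦ G a b c u) u) u := fun u hu ↦
      (hdiff a b c u hab hbc (by linarith [hu.1])).2.2.2.hasDerivAt
    exact exists_hasDerivAt_eq_slope _ _ (by linarith) (HasDerivAt.continuousOn fun u hu ↦ hd u hu)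
      fun u hu ↦ hd u (Ioo_subset_Icc_self hu)
  -- the four MVT values sum to zero
  have hsum : deriv (fun u ↦ G u (b + s) (c + s) (y + s)) ξ₁ + deriv (fun u ↦ G a u (c + s) (y + s)) ξ₂
      + deriv (fun u ↦ G a b u (y + s)) ξ₃ + deriv (fun u ↦ G a b c u) ξ₄ = 0 := by
    rw [hmvt₁, hmvt₂, hmvt₃, hmvt₄, show a + s - a = s by ring, show b + s - b = s by ring,
      show c + s - c = s by ring, show y + s - y = s by ring, ← add_div, ← add_div, ← add_div, htr]
    rw [div_eq_zero_iff]
    left; ring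
  -- each MVT value is within `ε/4` of the partial at the point
  have hdist : ∀ q : ℝ × ℝ × ℝ × ℝ, |q.1 - a| ≤ s → |q.2.1 - b| ≤ s → |q.2.2.1 - c| ≤ s →
      |q.2.2.2 - y| ≤ s → ∀ δ, s < δ → dist q (a, b, c, y) < δ := by
    rintro ⟨q₁, q₂, q₃, q₄⟩ h1 h2 h3 h4 δ hδ
    simp only [Prod.dist_eq, Real.dist_eq, max_lt_iff]
    dsimp only at h1 h2 h3 h4
    exact ⟨by linarith, by linarith, by linarith, by linarith⟩
  have e₁ : |deriv (fun u ↦ G u (b + s) (c + s) (y + s)) ξ₁ - deriv (fun u ↦ G u b c y) a| < ε / 4 := by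
    have := hn₁ (ξ₁, b + s, c + s, y + s) (hdist _ (by rw [abs_le]; constructor <;> linarith [hξ₁.1, hξ₁.2])
      (hus b) (hus c) (hus y) δ₁ hs₁)
    simpa only [hD₁] using this
  have e₂ : |deriv (fun u ↦ G a u (c + s) (y + s)) ξ₂ - deriv (fun u ↦ G a u c y) b| < ε / 4 := by
    have := hn₂ (a, ξ₂, c + s, y + s) (hdist _ (h00 a)
      (by rw [abs_le]; constructor <;> linarith [hξ₂.1, hξ₂.2]) (hus c) (hus y) δ₂ hs₂)
    simpa only [hD₂] using this
  have e₃ : |deriv (fun u ↦ G a b u (y + s)) ξ₃ - deriv (fun u ↦ G a b u y) c| < ε / 4 := by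
    have := hn₃ (a, b, ξ₃, y + s) (hdist _ (h00 a) (h00 b)
      (by rw [abs_le]; constructor <;> linarith [hξ₃.1, hξ₃.2]) (hus y) δ₃ hs₃)
    simpa only [hD₃] using this
  have e₄ : |deriv (fun u ↦ G a b c u) ξ₄ - deriv (fun u ↦ G a b c u) y| < ε / 4 := by
    have := hn₄ (a, b, c, ξ₄) (hdist _ (h00 a) (h00 b) (h00 c)
      (by rw [abs_le]; constructor <;> linarith [hξ₄.1, hξ₄.2]) δ₄ hs₄)
    simpa only [hD₄] using this
  rw [abs_sub_lt_iff] at e₁ e₂ e₃ e₄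
  rw [hS, abs_le]
  constructor <;> linarith [e₁.1, e₁.2, e₂.1, e₂.2, e₃.1, e₃.2, e₄.1, e₄.2]

end JointLimit

/-- **Registered extra stub of line `Sketch` (lead c4-0): the translation identity of the four mark
densities of every joint subsequential limit**, closed form of `sum_partials_eq_zero`. [folklore] -/
theorem stub_translationIdentity :
    ∀ θ : ℕ → ℕ, StrictMono θ → ∀ G : ℝ → ℝ → ℝ → ℝ → ℝ,
      (∀ a b c y : ℝ, a < b → b < c → c < y →
        Tendsto (fun n ↦ μ.real (openCrossing halfPlane (arcA a b (θ n))
          (rowIcc ⌊c * (θ n : ℕ)⌋ ⌊y * (θ n : ℕ)⌋))) atTop (𝓝 (G a b c y))) →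
      ∀ a b c y : ℝ, a < b → b < c → c < y →
        deriv (fun s ↦ G s b c y) a + deriv (fun s ↦ G a s c y) b + deriv (fun s ↦ G a b s y) c +
          deriv (fun s ↦ G a b c s) y = 0 :=
  fun _ hθ _ hG _ _ _ _ hab hbc hcy ↦ sum_partials_eq_zero hG hθ hab hbc hcy

end Density

end Summit.CriticalPhenomena.CardyFormulaZ2.Cruxes.HalfPlaneMarkDensityLaw.SketchLine
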